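import Summits.AtomisticToContinuum.FouriersLaw.Theses.LatticeLandauDamping
import Summits.AtomisticToContinuum.FouriersLaw.Theses.EmbeddedDrudeMourre
import Summits.AtomisticToContinuum.FouriersLaw.Theorems.ConductanceLowerBound.Negative.GammaZeroNonUniqueness
import Literature.Barriers.AtomisticToContinuum.FixedLengthNoConductivityControl
import Literature.Barriers.AtomisticToContinuum.HarmonicCrystalBallisticProofs

/-!
# `AbelThermodynamicLimit` / Negative (1): load-bearing hypotheses, degenerate corners, barrier reduction

Support file (`--supports stmt-AtomisticToContinuum-14013`) of the standing disprover seat of the crux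
`LatticeLandauDamping.AbelThermodynamicLimit` (stmt-AtomisticToContinuum-14013); the crux is `rfl`-identical to its
twin `EmbeddedDrudeMourre.AbelThermodynamicLimit` (stmt-AtomisticToContinuum-12596, `crux_eq_twin`), so every lemma
here serves both items.  The crux is NOT refuted; this file lands, importably, what is certain around it (the
content of §1–§3 of the shared `Cruxes/AbelThermodynamicLimit/Disproof.lean`, first written by the twin's seat,
re-proved here over landed lemmas and sharpened by the fact that `NessUnique` is now PROVED):

* `abelThermodynamicLimit_iff_uniqFree` — weak-NESS uniqueness being a theorem (`NessUnique_holds`), the crux is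
  EQUIVALENT to its uniqueness-free specialisation: a refutation no longer owes a uniqueness proof;
* `response_unique` — the response sequence `D_N` of the conclusion is canonical (family-independent);
* `conclusion_false_gamma_zero` + `exists_witness_iff_gamma` — the bath coupling is LOAD-BEARING and enters only
  through the finite chains: at `γ = 0` the conclusion is false for every would-be witness (currentless Dirac
  family), while the witness hypothesis is literally `γ`-blind; with the landed `pinnedChain_not_unique_gamma_zero`
  the `γ ≥ 0` extension of the crux holds at `γ = 0` only VACUOUSLY (`cruxShape_gamma_zero_vacuous`);
* `tlconv_false_of_nonpos` — the guard `0 < T` is load-bearing for the conclusion (and `no_gibbs_of_nonpos`: there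
  is no DLR state at `T ≤ 0`, so it is harmless on the hypothesis side);
* `tlconv_harmonic_false` — `lam, β > 0` are load-bearing: at the harmonic corner the conclusion fails for EVERY `κ`
  (PROVED Rieder–Lebowitz–Lieb ballistic law), so any proof must degenerate as `(lam, β) → 0`;
* `hasBoundedResponse_of_abelThermodynamicLimit` — BARRIER REDUCTION without any uniqueness hypothesis: the crux plus
  Abelian witnesses at all `T > 0` yields `HasBoundedResponse (pinnedChain …)`, the `N`-uniform conductivity bound the
  catalogue entry `FixedLengthNoConductivityControl` records as never obtained for a deterministic anharmonic bulk.

No new definitions.  cdisprove seat refuter-cdisprove-stmt-AtomisticToContinuum-14013-0, 2026-08-16.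
-/

noncomputable section

namespace Summit.AtomisticToContinuum.FouriersLaw.Theorems.AbelThermodynamicLimit.Negative

open MeasureTheory Filter Set Topology
open Literature.MathematicalPhysics.KineticTheory.HeatConduction
open Literature.Barriers.AtomisticToContinuum (HasBoundedResponse HarmonicChainBallisticFlux
  HarmonicChainBallisticFlux_holds)
open Summit.AtomisticToContinuum.FouriersLaw.Theses

/-! ## §0 Read-back -/

/-- The two route copies of the crux are the same proposition. [folklore] -/
theorem crux_eq_twin :
    LatticeLandauDamping.AbelThermodynamicLimit = EmbeddedDrudeMourre.AbelThermodynamicLimit :=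
  rfl

/-- **Uniqueness is a theorem, so the crux is its own uniqueness-free specialisation.**  Since
`LatticeLandauDamping.NessUnique` is PROVED (`NessUnique_holds`), `AbelThermodynamicLimit` is equivalent to the
statement with the weak-NESS-uniqueness antecedent deleted.  For provers: discharge `hU` by `NessUnique_holds`.
For refuters: a counterexample needs only a witness and a divergent / mismatched canonical response. [folklore] -/
theorem abelThermodynamicLimit_iff_uniqFree :
    LatticeLandauDamping.AbelThermodynamicLimit ↔
      ∀ ω₂ lam β γ : ℝ, 0 < ω₂ → 0 < lam → 0 < β → 0 < γ → ∀ T : ℝ, 0 < T →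
        (∃ (μT : Measure ChainConfig) (D : InfiniteChainDynamics (pinnedChain ω₂ lam β γ)) (κ : ℝ),
          (pinnedChain ω₂ lam β γ).IsChainGibbsMeasure T μT ∧ D.PreservesMeasure μT ∧
            (∀ t : ℝ, D.HasAbsConvergentCorrelation μT t) ∧ 0 < κ ∧
            Tendsto (fun ν : ℝ => (T ^ 2)⁻¹ *
                ∫ t in Ioi (0 : ℝ), Real.exp (-(ν * t)) * D.currentCorrelation μT t)
              (𝓝[>] (0 : ℝ)) (𝓝 κ)) →
        ∃ (μT : Measure ChainConfig) (D : InfiniteChainDynamics (pinnedChain ω₂ lam β γ)) (κ : ℝ),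
          ((pinnedChain ω₂ lam β γ).IsChainGibbsMeasure T μT ∧ D.PreservesMeasure μT ∧
            (∀ t : ℝ, D.HasAbsConvergentCorrelation μT t) ∧ 0 < κ ∧
            Tendsto (fun ν : ℝ => (T ^ 2)⁻¹ *
                ∫ t in Ioi (0 : ℝ), Real.exp (-(ν * t)) * D.currentCorrelation μT t)
              (𝓝[>] (0 : ℝ)) (𝓝 κ)) ∧
          ∀ μ : (N : ℕ) → ℝ → ℝ → Measure (PhaseSpace N),
            (∀ (N : ℕ) (T_L T_R : ℝ), 0 < T_L → 0 < T_R →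
              (pinnedChain ω₂ lam β γ).IsSteadyState N T_L T_R (μ N T_L T_R)) →
            ∀ Dn : ℕ → ℝ,
              (∀ N : ℕ, Tendsto (fun δ : ℝ =>
                  (pinnedChain ω₂ lam β γ).totalCurrent (μ N (T + δ / 2) (T - δ / 2)) / δ)
                (𝓝[≠] 0) (𝓝 (Dn N))) →
              Tendsto Dn atTop (𝓝 κ) := by
  constructor
  · intro h ω₂ lam β γ hω hl hβ hγ T hT hex
    exact h ω₂ lam β γ hω hl hβ hγ (LatticeLandauDamping.NessUnique_holds ω₂ lam β γ hω hl hβ hγ) T hT hex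
  · intro h ω₂ lam β γ hω hl hβ hγ _ T hT hex
    exact h ω₂ lam β γ hω hl hβ hγ T hT hex

/-! ## §1 The response sequence is canonical -/

/-- **Canonical response.**  For admissible parameters two steady families have the same difference quotients
near `δ = 0` (weak-NESS uniqueness is PROVED and `T ± δ/2 > 0` once `|δ| < 2T`), hence the same response
sequence: the `Dn` of the crux's conclusion does not depend on the family. [folklore] -/
theorem response_unique {ω₂ lam β γ : ℝ} (hω : 0 < ω₂) (hl : 0 < lam) (hβ : 0 < β) (hγ : 0 < γ)
    {μ μ' : (N : ℕ) → ℝ → ℝ → Measure (PhaseSpace N)}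
    (hμ : ∀ (N : ℕ) (T_L T_R : ℝ), 0 < T_L → 0 < T_R →
      (pinnedChain ω₂ lam β γ).IsSteadyState N T_L T_R (μ N T_L T_R))
    (hμ' : ∀ (N : ℕ) (T_L T_R : ℝ), 0 < T_L → 0 < T_R →
      (pinnedChain ω₂ lam β γ).IsSteadyState N T_L T_R (μ' N T_L T_R))
    {T : ℝ} (hT : 0 < T) {Dn Dn' : ℕ → ℝ}
    (hD : ∀ N : ℕ, Tendsto (fun δ : ℝ =>
        (pinnedChain ω₂ lam β γ).totalCurrent (μ N (T + δ / 2) (T - δ / 2)) / δ) (𝓝[≠] 0) (𝓝 (Dn N)))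
    (hD' : ∀ N : ℕ, Tendsto (fun δ : ℝ =>
        (pinnedChain ω₂ lam β γ).totalCurrent (μ' N (T + δ / 2) (T - δ / 2)) / δ) (𝓝[≠] 0) (𝓝 (Dn' N))) :
    Dn = Dn' := by
  have hU := LatticeLandauDamping.NessUnique_holds ω₂ lam β γ hω hl hβ hγ
  funext N
  refine tendsto_nhds_unique ((hD N).congr' ?_) (hD' N)
  have h2 : ∀ᶠ δ in 𝓝 (0 : ℝ), δ < 2 * T := eventually_lt_nhds (by linarith)
  have h2' : ∀ᶠ δ in 𝓝 (0 : ℝ), -(2 * T) < δ := eventually_gt_nhds (by linarith)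
  filter_upwards [mem_nhdsWithin_of_mem_nhds h2, mem_nhdsWithin_of_mem_nhds h2'] with δ hlt hgt
  have ha : 0 < T + δ / 2 := by linarith
  have hb : 0 < T - δ / 2 := by linarith
  rw [hU N _ _ ha hb _ _ (hμ N _ _ ha hb) (hμ' N _ _ ha hb)]

/-! ## §2 The bath coupling `γ` is load-bearing and enters only through the finite chains -/

/-- The witness hypothesis of the crux is literally `γ`-blind: an Abelian Green–Kubo witness for
`pinnedChain ω₂ lam β γ` at `T` is one for `pinnedChain ω₂ lam β γ'` at `T`, for any `γ'` (the DLR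
specification, the infinite-volume dynamics and the bond currents never mention the baths; transport of the
dynamics is the identity on every field). [folklore] -/
theorem exists_witness_iff_gamma (ω₂ lam β γ γ' T : ℝ) :
    (∃ (μT : Measure ChainConfig) (D : InfiniteChainDynamics (pinnedChain ω₂ lam β γ)) (κ : ℝ),
        (pinnedChain ω₂ lam β γ).IsChainGibbsMeasure T μT ∧ D.PreservesMeasure μT ∧
          (∀ t : ℝ, D.HasAbsConvergentCorrelation μT t) ∧ 0 < κ ∧
          Tendsto (fun ν : ℝ => (T ^ 2)⁻¹ *
              ∫ t in Ioi (0 : ℝ), Real.exp (-(ν * t)) * D.currentCorrelation μT t)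
            (𝓝[>] (0 : ℝ)) (𝓝 κ)) ↔
      ∃ (μT : Measure ChainConfig) (D : InfiniteChainDynamics (pinnedChain ω₂ lam β γ')) (κ : ℝ),
        (pinnedChain ω₂ lam β γ').IsChainGibbsMeasure T μT ∧ D.PreservesMeasure μT ∧
          (∀ t : ℝ, D.HasAbsConvergentCorrelation μT t) ∧ 0 < κ ∧
          Tendsto (fun ν : ℝ => (T ^ 2)⁻¹ *
              ∫ t in Ioi (0 : ℝ), Real.exp (-(ν * t)) * D.currentCorrelation μT t)
            (𝓝[>] (0 : ℝ)) (𝓝 κ) := by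
  constructor
  · rintro ⟨μT, D, κ, h⟩
    exact ⟨μT, ⟨D.carrier, D.flow, D.mapsTo, D.flow_zero, D.isSolution, D.unique⟩, κ, h⟩
  · rintro ⟨μT, D, κ, h⟩
    exact ⟨μT, ⟨D.carrier, D.flow, D.mapsTo, D.flow_zero, D.isSolution, D.unique⟩, κ, h⟩

/-- **`0 < γ` is load-bearing (conclusion side).**  At `γ = 0` the conclusion of the crux is false outright,
for all `ω₂, lam, β, T`: the currentless Dirac family `δ_0` is steady at every `N` and every pair of bath
temperatures (landed `pinnedChain_isSteadyState_dirac_origin`), its response sequence is `0`, so the `κ` of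
any would-be witness would have to be `0`, contradicting `0 < κ`.  With `exists_witness_iff_gamma`: the bath
coupling must be USED by any proof, and it can enter only through the steadiness of the finite chains. [folklore] -/
theorem conclusion_false_gamma_zero (ω₂ lam β T : ℝ) :
    ¬ ∃ (μT : Measure ChainConfig) (D : InfiniteChainDynamics (pinnedChain ω₂ lam β 0)) (κ : ℝ),
        ((pinnedChain ω₂ lam β 0).IsChainGibbsMeasure T μT ∧ D.PreservesMeasure μT ∧
          (∀ t : ℝ, D.HasAbsConvergentCorrelation μT t) ∧ 0 < κ ∧
          Tendsto (fun ν : ℝ => (T ^ 2)⁻¹ *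
              ∫ t in Ioi (0 : ℝ), Real.exp (-(ν * t)) * D.currentCorrelation μT t)
            (𝓝[>] (0 : ℝ)) (𝓝 κ)) ∧
        ∀ μ : (N : ℕ) → ℝ → ℝ → Measure (PhaseSpace N),
          (∀ (N : ℕ) (T_L T_R : ℝ), 0 < T_L → 0 < T_R →
            (pinnedChain ω₂ lam β 0).IsSteadyState N T_L T_R (μ N T_L T_R)) →
          ∀ Dn : ℕ → ℝ,
            (∀ N : ℕ, Tendsto (fun δ : ℝ =>
                (pinnedChain ω₂ lam β 0).totalCurrent (μ N (T + δ / 2) (T - δ / 2)) / δ)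
              (𝓝[≠] 0) (𝓝 (Dn N))) →
            Tendsto Dn atTop (𝓝 κ) := by
  rintro ⟨μT, D, κ, ⟨-, -, -, hκ, -⟩, hTL⟩
  have h0 : Tendsto (fun _ : ℕ => (0 : ℝ)) atTop (𝓝 κ) := by
    refine hTL (fun N _ _ => Measure.dirac (0 : PhaseSpace N))
      (fun N T_L T_R _ _ => pinnedChain_isSteadyState_dirac_origin ω₂ lam β N T_L T_R) (fun _ => 0) ?_
    intro N
    simp only [pinnedChain_totalCurrent_dirac_origin, zero_div]
    exact tendsto_const_nhds
  have : κ = 0 := (tendsto_nhds_unique tendsto_const_nhds h0).symm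
  exact hκ.ne' this

/-- **The `γ ≥ 0` extension holds at `γ = 0`, but only vacuously.**  Weak-NESS uniqueness FAILS without baths
(landed `pinnedChain_not_unique_gamma_zero`: `δ_0` and the Gibbs measure are two steady states of the one-site
chain), so the crux shape "uniqueness → ∀ T > 0, (∃ witness) → ∃ witness ∧ thermodynamic limit" is true at `γ = 0`
for want of its antecedent — although by `conclusion_false_gamma_zero` its conclusion is false there whenever a
witness exists.  Moral: uniqueness is the only carrier of `γ` in the crux. [folklore] -/
theorem cruxShape_gamma_zero_vacuous {ω₂ lam β : ℝ} (hω : 0 < ω₂) (hl : 0 ≤ lam) (hβ : 0 ≤ β)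
    (Q : ℝ → Prop) :
    (∀ (N : ℕ) (T_L T_R : ℝ), 0 < T_L → 0 < T_R → ∀ μ ν : Measure (PhaseSpace N),
      (pinnedChain ω₂ lam β 0).IsSteadyState N T_L T_R μ →
        (pinnedChain ω₂ lam β 0).IsSteadyState N T_L T_R ν → μ = ν) → ∀ T : ℝ, 0 < T → Q T :=
  fun hU => absurd hU (pinnedChain_not_unique_gamma_zero hω hl hβ)

/-! ## §3 The guard `0 < T` -/

/-- **`0 < T` is load-bearing (conclusion side).**  For `T ≤ 0` the thermodynamic-limit clause fails for every
`κ ≠ 0` (admissible parameters): the temperatures `T ± δ/2` are never both positive, so a steady family (which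
exists, `pinnedChain_exists_isSteadyState`) may be continued by the currentless Dirac mass there, with zero
response. [folklore] -/
theorem tlconv_false_of_nonpos {ω₂ lam β γ T κ : ℝ} (hω : 0 < ω₂) (hl : 0 < lam) (hβ : 0 < β)
    (hγ : 0 < γ) (hT : T ≤ 0) (hκ : κ ≠ 0) :
    ¬ ∀ μ : (N : ℕ) → ℝ → ℝ → Measure (PhaseSpace N),
        (∀ (N : ℕ) (T_L T_R : ℝ), 0 < T_L → 0 < T_R →
          (pinnedChain ω₂ lam β γ).IsSteadyState N T_L T_R (μ N T_L T_R)) →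
        ∀ Dn : ℕ → ℝ,
          (∀ N : ℕ, Tendsto (fun δ : ℝ =>
              (pinnedChain ω₂ lam β γ).totalCurrent (μ N (T + δ / 2) (T - δ / 2)) / δ)
            (𝓝[≠] 0) (𝓝 (Dn N))) →
          Tendsto Dn atTop (𝓝 κ) := by
  classical
  intro hTL
  let μ : (N : ℕ) → ℝ → ℝ → Measure (PhaseSpace N) := fun N a b =>
    if h : 0 < a ∧ 0 < b then (pinnedChain_exists_isSteadyState hω hl hβ hγ N h.1 h.2).choose
    else Measure.dirac 0
  have hμ : ∀ (N : ℕ) (T_L T_R : ℝ), 0 < T_L → 0 < T_R →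
      (pinnedChain ω₂ lam β γ).IsSteadyState N T_L T_R (μ N T_L T_R) := by
    intro N a b ha hb
    simp only [μ, dif_pos (And.intro ha hb)]
    exact (pinnedChain_exists_isSteadyState hω hl hβ hγ N ha hb).choose_spec
  have h0 : ∀ N : ℕ, Tendsto (fun δ : ℝ =>
      (pinnedChain ω₂ lam β γ).totalCurrent (μ N (T + δ / 2) (T - δ / 2)) / δ) (𝓝[≠] 0) (𝓝 0) := by
    intro N
    refine (tendsto_const_nhds (x := (0 : ℝ))).congr' (Eventually.of_forall fun δ => ?_)
    have : ¬ (0 < T + δ / 2 ∧ 0 < T - δ / 2) := fun h => by linarith [h.1, h.2]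
    simp only [μ, dif_neg this, pinnedChain_totalCurrent_dirac_origin, zero_div]
  exact hκ (tendsto_nhds_unique (hTL μ hμ (fun _ => 0) h0) tendsto_const_nhds)

section NoGibbs
open Literature.Probability.LatticeModels (hamiltonianIn glueWith measurable_glueWith
  gibbsSpecOfPotential)

/-- The chain potential of `pinnedChain` is termwise non-negative (`ω₂, lam, β ≥ 0`). [folklore] -/
theorem chainPotential_nonneg {ω₂ lam β : ℝ} (γ : ℝ) (hω : 0 ≤ ω₂) (hl : 0 ≤ lam) (hβ : 0 ≤ β)
    (A : Finset ℤ) (σ : ChainConfig) : 0 ≤ (pinnedChain ω₂ lam β γ).chainPotential A σ := by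
  unfold OscillatorChain.chainPotential
  refine add_nonneg (Finset.sum_nonneg fun x _ => ?_) (Finset.sum_nonneg fun x _ => ?_)
  · split_ifs
    · simp only [pinnedChain]
      have h1 : 0 ≤ ω₂ * (σ x).1 ^ 2 / 2 := by positivity
      have h2 : 0 ≤ lam * (σ x).1 ^ 4 / 4 := by positivity
      have h3 : 0 ≤ (σ x).2 ^ 2 / 2 := by positivity
      linarith
    · exact le_rfl
  · split_ifs
    · simp only [pinnedChain]
      have h1 : 0 ≤ ((σ (x + 1)).1 - (σ x).1) ^ 2 / 2 := by positivity
      have h2 : 0 ≤ β * ((σ (x + 1)).1 - (σ x).1) ^ 4 / 4 := by positivity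
      linarith
    · exact le_rfl

/-- Lebesgue measure of the plane is infinite. [folklore] -/
theorem volume_univ_real_prod : (volume : Measure (ℝ × ℝ)) univ = ⊤ := by
  rw [Measure.volume_eq_prod, ← univ_prod_univ, Measure.prod_prod]
  simp

/-- The a priori measure of a nonempty volume is not finite. [folklore] -/
theorem not_isFiniteMeasure_apriori (Λ : Finset ℤ) (hΛ : Λ.Nonempty) (η : ChainConfig) :
    ¬ IsFiniteMeasure ((Measure.pi fun _ : Λ => (volume : Measure (ℝ × ℝ))).map (glueWith Λ · η)) := by
  intro hfin
  have h := measure_lt_top ((Measure.pi fun _ : Λ => (volume : Measure (ℝ × ℝ))).map (glueWith Λ · η)) univ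
  rw [Measure.map_apply (measurable_glueWith Λ η) MeasurableSet.univ, preimage_univ, Measure.pi_univ] at h
  simp only [volume_univ_real_prod, Finset.prod_const, Finset.card_univ] at h
  have hcard : Fintype.card {x // x ∈ Λ} ≠ 0 := by
    rw [Fintype.card_coe]; exact (Finset.card_pos.2 hΛ).ne'
  rw [ENNReal.top_pow hcard] at h
  exact lt_irrefl _ h

/-- **No Gibbs state at non-positive temperature** (hypothesis side of the guard): for `T ≤ 0` and
`ω₂, lam, β ≥ 0` the finite-volume kernel of the chain specification in the volume `{0}` is the zero measure
(`Measure.tilted` of the non-normalisable density `exp(-T⁻¹ H) ≥ 1` against an infinite a priori measure), so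
the DLR equation reads `0 = 1`.  Hence the crux's hypothesis is false at `T ≤ 0` as well: the guard is harmless
bookkeeping, unlike `0 < γ`. [folklore] -/
theorem no_gibbs_of_nonpos {ω₂ lam β T : ℝ} (γ : ℝ) (hω : 0 ≤ ω₂) (hl : 0 ≤ lam) (hβ : 0 ≤ β)
    (hT : T ≤ 0) (μ : Measure ChainConfig) : ¬ (pinnedChain ω₂ lam β γ).IsChainGibbsMeasure T μ := by
  classical
  intro hG
  set Λ : Finset ℤ := {0} with hΛ
  have hker : ∀ η : ChainConfig, (pinnedChain ω₂ lam β γ).chainSpecification T Λ η = 0 := by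
    intro η
    unfold OscillatorChain.chainSpecification gibbsSpecOfPotential
    refine tilted_of_not_integrable fun hint => ?_
    have h1 : Integrable (fun _ : ChainConfig => (1 : ℝ))
        ((Measure.pi fun _ : Λ => (volume : Measure (ℝ × ℝ))).map (glueWith Λ · η)) := by
      refine hint.mono' aestronglyMeasurable_const (Eventually.of_forall fun σ => ?_)
      rw [norm_one]
      apply Real.one_le_exp
      have hH : 0 ≤ hamiltonianIn (pinnedChain ω₂ lam β γ).chainPotential OscillatorChain.chainSupp Λ σ := by
        unfold hamiltonianIn
        exact Finset.sum_nonneg fun A _ => chainPotential_nonneg γ hω hl hβ A σ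
      have hTinv : -T⁻¹ ≥ 0 := by
        have : T⁻¹ ≤ 0 := inv_nonpos.2 hT
        linarith
      exact mul_nonneg hTinv hH
    rw [integrable_const_iff] at h1
    rcases h1 with h1 | h1
    · exact one_ne_zero h1
    · exact not_isFiniteMeasure_apriori Λ (by simp [hΛ]) η h1
  have hDLR := hG.2 Λ univ MeasurableSet.univ
  simp only [hker, Measure.coe_zero, Pi.zero_apply, lintegral_zero] at hDLR
  haveI := hG.1
  rw [measure_univ] at hDLR
  exact zero_ne_one hDLR

end NoGibbs

/-! ## §4 Anharmonicity `lam, β > 0`: the harmonic corner -/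

/-- **`lam, β > 0` are load-bearing (conclusion side), unconditionally.**  For the pinned HARMONIC chain
(`lam = β = 0`) the thermodynamic-limit clause fails for EVERY `κ` at every `T > 0`: along the
Rieder–Lebowitz–Lieb steady family (PROVED fact `HarmonicChainBallisticFlux_holds`) the response is
`D_{M+1} = M·c_{M+1} → +∞`.  Any proof of the crux must therefore degenerate as `(lam, β) → 0` — equivalently,
by the exact scaling `D_N(T; lam, β) = D_N(1; lam T, β T)`, as `T → 0` (barrier `LowTemperatureWeakAnharmonicity`).
[folklore] -/
theorem tlconv_harmonic_false {ω₂ γ T : ℝ} (hω : 0 < ω₂) (hγ : 0 < γ) (hT : 0 < T) (κ : ℝ) :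
    ¬ ∀ μ : (N : ℕ) → ℝ → ℝ → Measure (PhaseSpace N),
        (∀ (N : ℕ) (T_L T_R : ℝ), 0 < T_L → 0 < T_R →
          (pinnedChain ω₂ 0 0 γ).IsSteadyState N T_L T_R (μ N T_L T_R)) →
        ∀ Dn : ℕ → ℝ,
          (∀ N : ℕ, Tendsto (fun δ : ℝ =>
              (pinnedChain ω₂ 0 0 γ).totalCurrent (μ N (T + δ / 2) (T - δ / 2)) / δ)
            (𝓝[≠] 0) (𝓝 (Dn N))) →
          Tendsto Dn atTop (𝓝 κ) := by
  intro hTL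
  obtain ⟨μ, hμ, c, cinf, -, hresp, -, hup⟩ :=
    HarmonicChainBallisticFlux.ballisticLaw HarmonicChainBallisticFlux_holds hω hγ
  let Dn : ℕ → ℝ := fun N => Nat.casesOn N 0 fun M => (M : ℝ) * c (M + 1)
  have hD : ∀ N : ℕ, Tendsto (fun δ : ℝ =>
      (pinnedChain ω₂ 0 0 γ).totalCurrent (μ N (T + δ / 2) (T - δ / 2)) / δ) (𝓝[≠] 0) (𝓝 (Dn N)) := by
    intro N
    cases N with
    | zero =>
      show Tendsto (fun δ : ℝ => (pinnedChain ω₂ 0 0 γ).totalCurrent (μ 0 (T + δ / 2) (T - δ / 2)) / δ)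
        (𝓝[≠] 0) (𝓝 0)
      have h : Tendsto (fun _ : ℝ => (0 : ℝ)) (𝓝[≠] (0 : ℝ)) (𝓝 (0 : ℝ)) := tendsto_const_nhds
      simpa only [OscillatorChain.totalCurrent_zero, zero_div] using h
    | succ M => exact hresp T hT M
  have hlim : Tendsto (fun M : ℕ => Dn (M + 1)) atTop (𝓝 κ) :=
    (hTL μ hμ Dn hD).comp (tendsto_add_atTop_nat 1)
  exact (hlim.not_tendsto (disjoint_nhds_atTop κ)) hup

/-! ## §5 Barrier reduction -/

/-- **Barrier reduction, uniqueness-free.**  If the crux holds and Abelian Green–Kubo witnesses exist at every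
`T > 0` (the route's target `AbelGreenKubo` at the parameter point), then the finite-size conductivities of
`pinnedChain ω₂ lam β γ` are bounded uniformly in `N` along every steady family:
`Literature.Barriers.AtomisticToContinuum.HasBoundedResponse`, which the catalogue entry
`FixedLengthNoConductivityControl` records as obtained for NO deterministic anharmonic bulk (BLR 2000 §6.3,
"Nothing is known about the dependence of `D` on `L`").  Weak-NESS uniqueness is discharged by the PROVED
`NessUnique_holds`, so unlike the twin seat's version no uniqueness hypothesis appears. [folklore] -/
theorem hasBoundedResponse_of_abelThermodynamicLimit (h : LatticeLandauDamping.AbelThermodynamicLimit)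
    {ω₂ lam β γ : ℝ} (hω : 0 < ω₂) (hl : 0 < lam) (hβ : 0 < β) (hγ : 0 < γ)
    (hW : ∀ T : ℝ, 0 < T → ∃ (μT : Measure ChainConfig)
      (D : InfiniteChainDynamics (pinnedChain ω₂ lam β γ)) (κ : ℝ),
        (pinnedChain ω₂ lam β γ).IsChainGibbsMeasure T μT ∧ D.PreservesMeasure μT ∧
          (∀ t : ℝ, D.HasAbsConvergentCorrelation μT t) ∧ 0 < κ ∧
          Tendsto (fun ν : ℝ => (T ^ 2)⁻¹ *
              ∫ t in Ioi (0 : ℝ), Real.exp (-(ν * t)) * D.currentCorrelation μT t)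
            (𝓝[>] (0 : ℝ)) (𝓝 κ)) :
    HasBoundedResponse (pinnedChain ω₂ lam β γ) := by
  intro μ hμ T hT Dn hD
  obtain ⟨μT, D, κ, -, hTL⟩ := h ω₂ lam β γ hω hl hβ hγ
    (LatticeLandauDamping.NessUnique_holds ω₂ lam β γ hω hl hβ hγ) T hT (hW T hT)
  exact ((continuous_abs.tendsto _).comp (hTL μ hμ Dn hD)).bddAbove_range

/-- The same reduction phrased with the route's own target: `AbelThermodynamicLimit ∧ AbelGreenKubo` imply
`HasBoundedResponse` for every admissible chain. [folklore] -/
theorem hasBoundedResponse_of_abelThermodynamicLimit_of_abelGreenKubo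
    (h : LatticeLandauDamping.AbelThermodynamicLimit) (hGK : LatticeLandauDamping.AbelGreenKubo)
    {ω₂ lam β γ : ℝ} (hω : 0 < ω₂) (hl : 0 < lam) (hβ : 0 < β) (hγ : 0 < γ) :
    HasBoundedResponse (pinnedChain ω₂ lam β γ) :=
  hasBoundedResponse_of_abelThermodynamicLimit h hω hl hβ hγ fun T hT => hGK ω₂ lam β γ hω hl hβ hγ T hT

end Summit.AtomisticToContinuum.FouriersLaw.Theorems.AbelThermodynamicLimit.Negative

end
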